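import Summits.ResolutionOfSingularities.ResolutionOfSingularities.Theorems.PAlterationPialtTameKnownCases
import Literature.AlgebraicGeometry.Resolution.PrincipalizationToResolution
import Literature.AlgebraicGeometry.Resolution.QuasiProjectiveResolution
import Literature.AlgebraicGeometry.Resolution.ResolutionGlue
import Mathlib.AlgebraicGeometry.Morphisms.Finite
import Mathlib.AlgebraicGeometry.Morphisms.UniversallyInjective
import HarnessLib

/-!
# `Pialt` (crux stmt-ResolutionOfSingularities-0555), line `SketchIdeator2` / Card A: transfer of tameness, I

Helper file for the OPEN stub `stub_tameResolution` (`TameResolution_p`) of the lead's skeleton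
`radicially-regular-endgame` (`--supports stmt-ResolutionOfSingularities-0555`; it does not close
the item). Tier T of `Cruxes/Pialt/STUB-PLAN-stub_tameResolution.md` (T0, T1, T2): the
predicate plumbing every later step reuses.

Vocabulary (always INLINED in the statements, as in the registered stub): an integral scheme
`Z` is **radicially regular (RR)** if an integral regular `W` maps onto it by a finite,
universally injective, surjective `W → Z`; **locally RR (LRR)** if every point has an RR open
neighbourhood; a **tame resolution** of an integral `X` is a proper birational `π : Z → X` with
`Z` integral, normal (all stalks integrally closed) and LRR; `X` is **tame** if it has one.

* `rr_of_iso`, `lrr_of_iso` — RR / LRR transport along isomorphisms.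
* `lrr_opens`, `lrr_of_isOpenImmersion` — LRR passes to open subschemes (restrict the RR witness
  `W → V` over `V ∩ U` and use `Scheme.restrictRestrictComm`), hence along open immersions.
* `tame_of_isBirational` (T1) — tameness DESCENDS along proper birational morphisms
  (`IsBirational.comp`).
* `tame_opens`, `tame_of_isOpenImmersion`, `tame_of_iso` (T2) — tameness passes to non-empty
  open subschemes (`π ∣_ U`, `IsBirational.morphismRestrict`, `lrr_opens`), along open
  immersions with non-empty source, and along isomorphisms.
-/

set_option linter.dupNamespace false -- mandated namespace of this single-conjunct summit

noncomputable section

open CategoryTheory CategoryTheory.Limits AlgebraicGeometry TopologicalSpace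
open Literature.AlgebraicGeometry.Resolution

namespace Summit.ResolutionOfSingularities.ResolutionOfSingularities.Theorems.Pialt.RadiciallyRegular

/-! ## RR and LRR under isomorphisms and open immersions (T0) -/

/-- **RR transports along isomorphisms**: if an integral regular `W` maps finitely, universally
injectively and surjectively onto `Z` and `e : Z ≅ Z'`, then `W → Z → Z'` does the same for
`Z'`. [folklore] -/
theorem rr_of_iso {Z Z' : Scheme.{0}} (e : Z ⟶ Z') [IsIso e]
    (hZ : ∃ (W : Scheme.{0}) (h : W ⟶ Z), IsIntegral W ∧ Scheme.IsRegular W ∧ IsFinite h ∧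
      UniversallyInjective h ∧ Function.Surjective h.base) :
    ∃ (W : Scheme.{0}) (h : W ⟶ Z'), IsIntegral W ∧ Scheme.IsRegular W ∧ IsFinite h ∧
      UniversallyInjective h ∧ Function.Surjective h.base := by
  obtain ⟨W, h, hW, hreg, hfin, hui, hsurj⟩ := hZ
  haveI := hfin
  haveI := hui
  haveI : Surjective h := ⟨hsurj⟩
  refine ⟨W, h ≫ e, hW, hreg, inferInstance, ?_, Surjective.surj⟩
  exact MorphismProperty.comp_mem _ _ _ hui inferInstance

/-- **LRR transports along isomorphisms**: for `e : Z ≅ Z'` and `z' ∈ Z'`, an RR open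
neighbourhood `V ∋ e⁻¹ z'` gives the RR open neighbourhood `e(V) = (e⁻¹)⁻¹ V ∋ z'`, the witness
being composed with the isomorphism `V ≅ (e⁻¹)⁻¹ V` (`rr_of_iso`). [folklore] -/
theorem lrr_of_iso {Z Z' : Scheme.{0}} (e : Z ⟶ Z') [IsIso e]
    (hZ : ∀ z : Z, ∃ V : Z.Opens, z ∈ V ∧ ∃ (W : Scheme.{0}) (h : W ⟶ (V : Scheme.{0})),
      IsIntegral W ∧ Scheme.IsRegular W ∧ IsFinite h ∧ UniversallyInjective h ∧
        Function.Surjective h.base) :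
    ∀ z' : Z', ∃ V : Z'.Opens, z' ∈ V ∧ ∃ (W : Scheme.{0}) (h : W ⟶ (V : Scheme.{0})),
      IsIntegral W ∧ Scheme.IsRegular W ∧ IsFinite h ∧ UniversallyInjective h ∧
        Function.Surjective h.base := by
  intro z'
  obtain ⟨V, hzV, hV⟩ := hZ ((inv e).base z')
  refine ⟨(inv e) ⁻¹ᵁ V, hzV, ?_⟩
  haveI : IsIso ((inv e) ∣_ V) := inferInstance
  exact rr_of_iso (inv ((inv e) ∣_ V)) hV

/-- **LRR passes to open subschemes.** If every point of `Z` has an open neighbourhood `V`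
dominated by an integral regular scheme through a finite, universally injective, surjective
`h : W → V`, then so does every point `u` of an open `U ⊆ Z`: the neighbourhood is `U ∩ V`, the
witness is the restriction of `h` over `V ∩ U ⊆ V` (finite, universally injective and surjective
are Zariski-local at the target; a non-empty open of the integral regular `W` is integral and
regular), transported along `V ∩ U ≅ U ∩ V` (`Scheme.restrictRestrictComm`). [folklore] -/
theorem lrr_opens {Z : Scheme.{0}} (U : Z.Opens)
    (hZ : ∀ z : Z, ∃ V : Z.Opens, z ∈ V ∧ ∃ (W : Scheme.{0}) (h : W ⟶ (V : Scheme.{0})),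
      IsIntegral W ∧ Scheme.IsRegular W ∧ IsFinite h ∧ UniversallyInjective h ∧
        Function.Surjective h.base) :
    ∀ u : (U : Scheme.{0}), ∃ V : (U : Scheme.{0}).Opens, u ∈ V ∧
      ∃ (W : Scheme.{0}) (h : W ⟶ (V : Scheme.{0})),
        IsIntegral W ∧ Scheme.IsRegular W ∧ IsFinite h ∧ UniversallyInjective h ∧
          Function.Surjective h.base := by
  intro u
  obtain ⟨V, huV, W, h, hW, hreg, hfin, hui, hsurj⟩ := hZ (U.ι.base u)
  haveI := hW
  haveI := hfin
  haveI := hui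
  -- the point `u`, seen in `V`, lies in the open `V ∩ U` of `V`
  have huV' : (⟨U.ι.base u, huV⟩ : (V : Scheme.{0})) ∈ V.ι ⁻¹ᵁ U := by
    show (V.ι.base ⟨U.ι.base u, huV⟩) ∈ U
    rw [Scheme.Opens.ι_apply]
    exact (show U.ι.base u ∈ U by rw [Scheme.Opens.ι_apply]; exact u.2)
  -- the restriction of `h` over `V ∩ U`
  haveI : UniversallyInjective (h ∣_ (V.ι ⁻¹ᵁ U)) := IsZariskiLocalAtTarget.restrict ‹_› _
  haveI hsurj' : Surjective (h ∣_ (V.ι ⁻¹ᵁ U)) :=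
    IsZariskiLocalAtTarget.restrict (P := @Surjective) ⟨hsurj⟩ _
  -- its source is a non-empty open of the integral regular `W`
  obtain ⟨w, hw⟩ := hsurj ⟨U.ι.base u, huV⟩
  haveI : Nonempty (h ⁻¹ᵁ (V.ι ⁻¹ᵁ U) : W.Opens) :=
    ⟨⟨w, show h.base w ∈ V.ι ⁻¹ᵁ U by rw [hw]; exact huV'⟩⟩
  have hreg' : Scheme.IsRegular (h ⁻¹ᵁ (V.ι ⁻¹ᵁ U) : W.Opens) :=
    hreg.of_isOpenImmersion (h ⁻¹ᵁ (V.ι ⁻¹ᵁ U)).ι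
  -- transport along `V ∩ U ≅ U ∩ V`
  let e : ((V.ι ⁻¹ᵁ U : V.toScheme.Opens) : Scheme.{0}) ≅ (U.ι ⁻¹ᵁ V : U.toScheme.Opens) :=
    (Z.restrictRestrictComm U V).symm
  refine ⟨U.ι ⁻¹ᵁ V, ?_, (h ⁻¹ᵁ (V.ι ⁻¹ᵁ U) : W.Opens), (h ∣_ (V.ι ⁻¹ᵁ U)) ≫ e.hom,
    inferInstance, hreg', inferInstance, ?_, Surjective.surj⟩
  · show U.ι.base u ∈ V
    exact huV
  · exact MorphismProperty.comp_mem _ _ _ ‹_› inferInstance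

/-- **LRR transports along open immersions** (`lrr_opens` for `j.opensRange`, then `lrr_of_iso`
along `j.opensRange ≅ U`). [folklore] -/
theorem lrr_of_isOpenImmersion {U Z : Scheme.{0}} (j : U ⟶ Z) [IsOpenImmersion j]
    (hZ : ∀ z : Z, ∃ V : Z.Opens, z ∈ V ∧ ∃ (W : Scheme.{0}) (h : W ⟶ (V : Scheme.{0})),
      IsIntegral W ∧ Scheme.IsRegular W ∧ IsFinite h ∧ UniversallyInjective h ∧
        Function.Surjective h.base) :
    ∀ u : U, ∃ V : U.Opens, u ∈ V ∧ ∃ (W : Scheme.{0}) (h : W ⟶ (V : Scheme.{0})),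
      IsIntegral W ∧ Scheme.IsRegular W ∧ IsFinite h ∧ UniversallyInjective h ∧
        Function.Surjective h.base :=
  lrr_of_iso (Scheme.Hom.isoOpensRange j).inv (lrr_opens j.opensRange hZ)

/-! ## Tameness descends along proper birational morphisms (T1) -/

/-- **Tameness descends along modifications.** If `ρ : X' → X` is proper and birational and
`X'` has a tame resolution `π : Z → X'` (proper birational, `Z` integral, normal, LRR), then
`π ≫ ρ` is a tame resolution of `X` (`IsBirational.comp`). [folklore] -/
theorem tame_of_isBirational {X' X : Scheme.{0}} (ρ : X' ⟶ X) [IsProper ρ] (hρ : IsBirational ρ)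
    (h : ∃ (Z : Scheme.{0}) (π : Z ⟶ X'), IsProper π ∧ IsBirational π ∧ IsIntegral Z ∧
      (∀ z : Z, IsIntegrallyClosed (Z.presheaf.stalk z)) ∧
      ∀ z : Z, ∃ U : Z.Opens, z ∈ U ∧ ∃ (W : Scheme.{0}) (h : W ⟶ (U : Scheme.{0})),
        IsIntegral W ∧ Scheme.IsRegular W ∧ IsFinite h ∧ UniversallyInjective h ∧
          Function.Surjective h.base) :
    ∃ (Z : Scheme.{0}) (π : Z ⟶ X), IsProper π ∧ IsBirational π ∧ IsIntegral Z ∧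
      (∀ z : Z, IsIntegrallyClosed (Z.presheaf.stalk z)) ∧
      ∀ z : Z, ∃ U : Z.Opens, z ∈ U ∧ ∃ (W : Scheme.{0}) (h : W ⟶ (U : Scheme.{0})),
        IsIntegral W ∧ Scheme.IsRegular W ∧ IsFinite h ∧ UniversallyInjective h ∧
          Function.Surjective h.base := by
  obtain ⟨Z, π, hπ, hbir, hZ, hN, hL⟩ := h
  haveI := hπ
  exact ⟨Z, π ≫ ρ, inferInstance, hbir.comp hρ, hZ, hN, hL⟩

/-! ## Tameness passes to open subschemes and along isomorphisms (T2) -/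

/-- **Tameness passes to non-empty opens.** If `π : Z → X` is a tame resolution and `U ⊆ X` is a
non-empty open, then `π ∣_ U : π⁻¹U → U` is a tame resolution of `U`: proper (base change),
birational (`IsBirational.morphismRestrict`), with source a non-empty (`π` is dominant) open of
`Z`, hence integral, normal (same stalks) and LRR (`lrr_opens`). [folklore] -/
theorem tame_opens {X : Scheme.{0}} (U : X.Opens) (hU : (U : Set X).Nonempty)
    (h : ∃ (Z : Scheme.{0}) (π : Z ⟶ X), IsProper π ∧ IsBirational π ∧ IsIntegral Z ∧
      (∀ z : Z, IsIntegrallyClosed (Z.presheaf.stalk z)) ∧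
      ∀ z : Z, ∃ U : Z.Opens, z ∈ U ∧ ∃ (W : Scheme.{0}) (h : W ⟶ (U : Scheme.{0})),
        IsIntegral W ∧ Scheme.IsRegular W ∧ IsFinite h ∧ UniversallyInjective h ∧
          Function.Surjective h.base) :
    ∃ (Z : Scheme.{0}) (π : Z ⟶ (U : Scheme.{0})), IsProper π ∧ IsBirational π ∧ IsIntegral Z ∧
      (∀ z : Z, IsIntegrallyClosed (Z.presheaf.stalk z)) ∧
      ∀ z : Z, ∃ U : Z.Opens, z ∈ U ∧ ∃ (W : Scheme.{0}) (h : W ⟶ (U : Scheme.{0})),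
        IsIntegral W ∧ Scheme.IsRegular W ∧ IsFinite h ∧ UniversallyInjective h ∧
          Function.Surjective h.base := by
  obtain ⟨Z, π, hπ, hbir, hZ, hN, hL⟩ := h
  haveI := hπ
  haveI := hZ
  -- `π⁻¹ U` is a non-empty open of the integral `Z` (`π` is dominant)
  haveI : IsDominant π := hbir.isDominant
  haveI : Nonempty (π ⁻¹ᵁ U : Z.Opens) := by
    obtain ⟨z, hz⟩ := π.denseRange.exists_mem_open U.isOpen hU
    exact ⟨⟨z, hz⟩⟩
  refine ⟨(π ⁻¹ᵁ U : Z.Opens), π ∣_ U, inferInstance, hbir.morphismRestrict U, inferInstance,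
    fun z => ?_, lrr_opens (π ⁻¹ᵁ U) hL⟩
  haveI := hN ((π ⁻¹ᵁ U).ι.base z)
  exact IsIntegrallyClosed.of_equiv (asIso ((π ⁻¹ᵁ U).ι.stalkMap z)).commRingCatIsoToRingEquiv

/-- **Tameness transports along isomorphisms** (`e : X ≅ X'`: post-compose the tame resolution
with `e`, `IsBirational.comp_iso`). [folklore] -/
theorem tame_of_iso {X X' : Scheme.{0}} (e : X ⟶ X') [IsIso e]
    (h : ∃ (Z : Scheme.{0}) (π : Z ⟶ X), IsProper π ∧ IsBirational π ∧ IsIntegral Z ∧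
      (∀ z : Z, IsIntegrallyClosed (Z.presheaf.stalk z)) ∧
      ∀ z : Z, ∃ U : Z.Opens, z ∈ U ∧ ∃ (W : Scheme.{0}) (h : W ⟶ (U : Scheme.{0})),
        IsIntegral W ∧ Scheme.IsRegular W ∧ IsFinite h ∧ UniversallyInjective h ∧
          Function.Surjective h.base) :
    ∃ (Z : Scheme.{0}) (π : Z ⟶ X'), IsProper π ∧ IsBirational π ∧ IsIntegral Z ∧
      (∀ z : Z, IsIntegrallyClosed (Z.presheaf.stalk z)) ∧
      ∀ z : Z, ∃ U : Z.Opens, z ∈ U ∧ ∃ (W : Scheme.{0}) (h : W ⟶ (U : Scheme.{0})),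
        IsIntegral W ∧ Scheme.IsRegular W ∧ IsFinite h ∧ UniversallyInjective h ∧
          Function.Surjective h.base := by
  obtain ⟨Z, π, hπ, hbir, hZ, hN, hL⟩ := h
  haveI := hπ
  exact ⟨Z, π ≫ e, inferInstance, hbir.comp_iso e, hZ, hN, hL⟩

/-- **Tameness transports along open immersions with non-empty source** (`tame_opens` for
`j.opensRange`, then `tame_of_iso` along `j.opensRange ≅ U`). [folklore] -/
theorem tame_of_isOpenImmersion {U X : Scheme.{0}} [Nonempty U] (j : U ⟶ X) [IsOpenImmersion j]
    (h : ∃ (Z : Scheme.{0}) (π : Z ⟶ X), IsProper π ∧ IsBirational π ∧ IsIntegral Z ∧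
      (∀ z : Z, IsIntegrallyClosed (Z.presheaf.stalk z)) ∧
      ∀ z : Z, ∃ U : Z.Opens, z ∈ U ∧ ∃ (W : Scheme.{0}) (h : W ⟶ (U : Scheme.{0})),
        IsIntegral W ∧ Scheme.IsRegular W ∧ IsFinite h ∧ UniversallyInjective h ∧
          Function.Surjective h.base) :
    ∃ (Z : Scheme.{0}) (π : Z ⟶ U), IsProper π ∧ IsBirational π ∧ IsIntegral Z ∧
      (∀ z : Z, IsIntegrallyClosed (Z.presheaf.stalk z)) ∧
      ∀ z : Z, ∃ U : Z.Opens, z ∈ U ∧ ∃ (W : Scheme.{0}) (h : W ⟶ (U : Scheme.{0})),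
        IsIntegral W ∧ Scheme.IsRegular W ∧ IsFinite h ∧ UniversallyInjective h ∧
          Function.Surjective h.base := by
  have hne : ((j.opensRange : X.Opens) : Set X).Nonempty := by
    obtain ⟨u⟩ := (inferInstance : Nonempty U)
    exact ⟨j.base u, ⟨u, rfl⟩⟩
  exact tame_of_iso (Scheme.Hom.isoOpensRange j).inv (tame_opens j.opensRange hne h)

end Summit.ResolutionOfSingularities.ResolutionOfSingularities.Theorems.Pialt.RadiciallyRegular

end
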